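import Literature.MathematicalPhysics.QuantumLattice.GrassmannRelabelling
import HarnessLib

/-!
# Kernels of products of generators: iterated Grassmann derivatives as delta determinants

Topic `Literature/MathematicalPhysics/QuantumLattice`; the kernel calculus missing from
`GrassmannKernels.lean` (which computes only `kernel ψ(Y) 1`).  For a product of generators
`ψ(Y_0)⋯ψ(Y_{m-1})` and labels `X_0, …, X_{m-1}`, the iterated left derivative
`∂_{X_{m-1}} ⋯ ∂_{X_0}` (`iterDeriv`) has constant part the DETERMINANT of the delta matrix
`[δ_{X_i, Y_j}]_{i,j}` — the signed sum over the permutations `σ` with `X = Y ∘ σ` (Berezin 1966, Ch. I §3;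
Salmhofer 1999, (4.95): the coefficient functions are totally antisymmetric) — and it vanishes in every
other degree.  Hence the kernel of a "presented" polynomial `Σ_Y φ(Y) ψ(Y_0)⋯ψ(Y_{m-1})` is the
antisymmetrisation of `φ`, bounded in absolute value by `(m!)⁻¹ Σ_σ |φ(X ∘ σ)|`, which is what carries the
`L¹–L^∞` estimates of the tree expansion (`FermionicTreeExpansionKernelDecay.lean`,
`GrassmannKernelVertices.lean`) over to Salmhofer's kernel norms.

* `genProd R Y = ψ(Y_0)⋯ψ(Y_{m-1})`, `genProd_succ`;
* `grassmannDeriv_genProd` — the graded Leibniz rule: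
  `∂_X (ψ(Y_0)⋯ψ(Y_m)) = Σ_k (-1)^k δ_{X,Y_k} ψ(Y_0)⋯ψ̂(Y_k)⋯ψ(Y_m)`;
* (`iterDeriv_succ_apply` of `GrassmannRelabelling.lean`: `∂_{X_m}⋯∂_{X_0} = (∂_{X_m}⋯∂_{X_1}) ∘ ∂_{X_0}`);
* **`constPart_iterDeriv_genProd`** — `constPart (∂_{X_{m-1}}⋯∂_{X_0} ψ(Y_0)⋯ψ(Y_{m-1})) = det [δ_{X_i,Y_j}]`
  (Laplace expansion along the first row, `Matrix.det_succ_row_zero`);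
  `constPart_iterDeriv_genProd_of_ne` — zero when the degrees differ; `kernel_genProd`, `kernel_genProd_of_ne`;
* `deltaMatrix_det_eq_zero_of_not_injective`, `norm_det_deltaMatrix_le_one` — the delta determinant
  vanishes for non-injective `X` and has norm `≤ 1` for injective `X`.

Everything is proved; no named fact.

## Sources

F. A. Berezin, *The Method of Second Quantization* (1966), Ch. I §3 (`Berezin1966`); M. Salmhofer,
*Renormalization* (1999), §4.3 (4.95) (`Salmhofer1999`); M. Salmhofer, Comm. Math. Phys. 194 (1998), §3.2
(3.12) (`Salmhofer1998`).
-/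

noncomputable section

namespace Literature.MathematicalPhysics.QuantumLattice

open GrassmannAlgebra Finset Matrix

section GenProd

variable (R : Type*) [CommRing R] {Γ : Type*} [DecidableEq Γ]

/-- The product of generators `ψ(Y_0) ψ(Y_1) ⋯ ψ(Y_{m-1})`, in this order. [folklore] -/
def genProd {m : ℕ} (Y : Fin m → Γ) : GrassmannAlgebra R Γ := (List.ofFn fun i => gen R (Y i)).prod

/-- The empty product is `1`. [folklore] -/
@[simp] theorem genProd_zero (Y : Fin 0 → Γ) : genProd R Y = 1 := by
  simp [genProd]

/-- Peeling the first generator: `ψ(Y_0)⋯ψ(Y_m) = ψ(Y_0) · (ψ(Y_1)⋯ψ(Y_m))`. [folklore] -/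
theorem genProd_succ {m : ℕ} (Y : Fin (m + 1) → Γ) : genProd R Y = gen R (Y 0) * genProd R (Fin.tail Y) := by
  rw [genProd, List.ofFn_succ, List.prod_cons]
  rfl

/-- Removing the index `k.succ` from `Y` keeps `Y 0` in front of `Y` with `k` removed from its tail.
[folklore] -/
theorem genProd_comp_succAbove_succ {m : ℕ} (Y : Fin (m + 2) → Γ) (k : Fin (m + 1)) :
    genProd R (Y ∘ k.succ.succAbove) = gen R (Y 0) * genProd R (Fin.tail Y ∘ k.succAbove) := by
  rw [genProd_succ]
  have h0 : (Y ∘ k.succ.succAbove) 0 = Y 0 := by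
    simp only [Function.comp_apply, Fin.succ_succAbove_zero]
  have ht : Fin.tail (Y ∘ k.succ.succAbove) = Fin.tail Y ∘ k.succAbove := by
    funext i
    simp only [Fin.tail, Function.comp_apply, Fin.succ_succAbove_succ]
  rw [h0, ht]

/-- **The graded Leibniz rule on a product of generators**:
`∂_X (ψ(Y_0)⋯ψ(Y_m)) = Σ_k (-1)^k δ_{X, Y_k} · ψ(Y_0)⋯ψ̂(Y_k)⋯ψ(Y_m)`. [cite: Berezin1966, Ch. I §3] -/
theorem grassmannDeriv_genProd : ∀ {m : ℕ} (X : Γ) (Y : Fin (m + 1) → Γ),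
    grassmannDeriv R X (genProd R Y) =
      ∑ k : Fin (m + 1), if X = Y k then ((-1 : R) ^ (k : ℕ)) • genProd R (Y ∘ k.succAbove) else 0
  | 0, X, Y => by
    rw [genProd_succ, genProd_zero, grassmannDeriv_gen_mul, grassmannDeriv_one, mul_zero, sub_zero,
      Fin.sum_univ_one]
    simp only [Fin.val_zero, pow_zero, one_smul, genProd_zero]
  | m + 1, X, Y => by
    rw [genProd_succ, grassmannDeriv_gen_mul, grassmannDeriv_genProd X (Fin.tail Y),
      Fin.sum_univ_succ (f := fun k : Fin (m + 2) =>
        if X = Y k then ((-1 : R) ^ (k : ℕ)) • genProd R (Y ∘ k.succAbove) else 0)]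
    -- the term `k = 0`: removing the first index leaves the tail
    have hhead : (if X = Y 0 then ((-1 : R) ^ ((0 : Fin (m + 2)) : ℕ)) • genProd R (Y ∘ (0 : Fin (m + 2)).succAbove)
        else 0) = if X = Y 0 then genProd R (Fin.tail Y) else 0 := by
      simp only [Fin.val_zero, pow_zero, one_smul, Fin.succAbove_zero]
      rfl
    rw [hhead, sub_eq_add_neg, mul_sum, ← sum_neg_distrib]
    congr 1
    refine sum_congr rfl fun k _ => ?_
    by_cases h : X = Fin.tail Y k
    · have h' : X = Y k.succ := h
      rw [if_pos h, if_pos h', genProd_comp_succAbove_succ, mul_smul_comm, ← neg_smul, Fin.val_succ, pow_succ,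
        mul_neg_one]
    · have h' : ¬X = Y k.succ := h
      rw [if_neg h, if_neg h', mul_zero, neg_zero]

omit [DecidableEq Γ] in
/-- No derivative is the identity. [folklore] -/
@[simp] theorem iterDeriv_zero_apply (X : Fin 0 → Γ) (F : GrassmannAlgebra R Γ) : iterDeriv R X F = F := by
  simp [iterDeriv]

/-- The **delta matrix** `[δ_{X_i, Y_j}]_{i,j}` of two label tuples. [folklore] -/
def deltaMatrix {m : ℕ} (X Y : Fin m → Γ) : Matrix (Fin m) (Fin m) R :=
  Matrix.of fun i j => if X i = Y j then 1 else 0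

/-- Unfolding `deltaMatrix`. [folklore] -/
@[simp] theorem deltaMatrix_apply {m : ℕ} (X Y : Fin m → Γ) (i j : Fin m) :
    deltaMatrix R X Y i j = if X i = Y j then 1 else 0 := rfl

/-- **The iterated derivative of a product of generators is the delta determinant**:
`constPart (∂_{X_{m-1}} ⋯ ∂_{X_0} ψ(Y_0)⋯ψ(Y_{m-1})) = det [δ_{X_i, Y_j}] = Σ_σ sign σ ∏_i δ_{X_i, Y_{σ i}}`
(the Laplace expansion along the first row is the graded Leibniz rule). [cite: Berezin1966, Ch. I §3] -/
theorem constPart_iterDeriv_genProd : ∀ {m : ℕ} (X Y : Fin m → Γ),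
    constPart R (iterDeriv R X (genProd R Y)) = (deltaMatrix R X Y).det
  | 0, X, Y => by
    rw [iterDeriv_zero_apply, genProd_zero, map_one, Matrix.det_isEmpty]
  | m + 1, X, Y => by
    rw [iterDeriv_succ_apply, grassmannDeriv_genProd, map_sum, map_sum, Matrix.det_succ_row_zero]
    refine sum_congr rfl fun k _ => ?_
    rw [deltaMatrix_apply]
    by_cases h : X 0 = Y k
    · rw [if_pos h, if_pos h, map_smul, map_smul, constPart_iterDeriv_genProd (fun i => X i.succ) (Y ∘ k.succAbove),
        smul_eq_mul, mul_one]
      rfl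
    · rw [if_neg h, if_neg h, map_zero, map_zero, mul_zero, zero_mul]

/-- **Degree mismatch**: the constant part of `∂_{X_{m'-1}}⋯∂_{X_0} ψ(Y_0)⋯ψ(Y_{m-1})` vanishes when
`m' ≠ m`. [folklore] -/
theorem constPart_iterDeriv_genProd_of_ne : ∀ {m' m : ℕ} (X : Fin m' → Γ) (Y : Fin m → Γ), m' ≠ m →
    constPart R (iterDeriv R X (genProd R Y)) = 0
  | 0, 0, _, _, h => absurd rfl h
  | 0, m + 1, X, Y, _ => by
    rw [iterDeriv_zero_apply, genProd_succ, map_mul, constPart_gen, zero_mul]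
  | m' + 1, 0, X, Y, _ => by
    rw [iterDeriv_succ_apply, genProd_zero, grassmannDeriv_one, map_zero, map_zero]
  | m' + 1, m + 1, X, Y, h => by
    rw [iterDeriv_succ_apply, grassmannDeriv_genProd, map_sum, map_sum]
    refine sum_eq_zero fun k _ => ?_
    by_cases hk : X 0 = Y k
    · rw [if_pos hk, map_smul, map_smul, constPart_iterDeriv_genProd_of_ne (fun i => X i.succ) (Y ∘ k.succAbove)
        (fun h' => h (by omega)), smul_zero]
    · rw [if_neg hk, map_zero, map_zero]

variable [Algebra ℚ R]

/-- **The kernel of a product of generators**: `kernel (ψ(Y_0)⋯ψ(Y_{m-1})) m X = (m!)⁻¹ det [δ_{X_i, Y_j}]`.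
[cite: Salmhofer1999, §4.3 (4.95)] -/
theorem kernel_genProd {m : ℕ} (X Y : Fin m → Γ) :
    kernel R (genProd R Y) m X = ((m.factorial : ℚ)⁻¹ • (1 : R)) * (deltaMatrix R X Y).det := by
  rw [kernel_def, constPart_iterDeriv_genProd]

/-- The kernels of a product of `m` generators vanish in the degrees `m' ≠ m`. [folklore] -/
theorem kernel_genProd_of_ne {m' m : ℕ} (X : Fin m' → Γ) (Y : Fin m → Γ) (h : m' ≠ m) :
    kernel R (genProd R Y) m' X = 0 := by
  rw [kernel_def, constPart_iterDeriv_genProd_of_ne R X Y h, mul_zero]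

omit [Algebra ℚ R] in
/-- The delta determinant vanishes when `X` repeats a label (two equal rows). [folklore] -/
theorem deltaMatrix_det_eq_zero_of_not_injective {m : ℕ} {X : Fin m → Γ} (hX : ¬Function.Injective X)
    (Y : Fin m → Γ) : (deltaMatrix R X Y).det = 0 := by
  obtain ⟨i, i', hii', hne⟩ : ∃ i i', X i = X i' ∧ i ≠ i' := by
    by_contra h
    push Not at h
    exact hX fun a b hab => h a b hab
  exact Matrix.det_zero_of_row_eq hne (funext fun j => by simp [deltaMatrix_apply, hii'])

omit [DecidableEq Γ] [Algebra ℚ R] in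
/-- Two permutations matching an injective `X` against `Y` coincide. [folklore] -/
theorem perm_eq_of_forall_eq {m : ℕ} {X Y : Fin m → Γ} (hX : Function.Injective X) {σ σ' : Equiv.Perm (Fin m)}
    (hσ : ∀ i, X i = Y (σ i)) (hσ' : ∀ i, X i = Y (σ' i)) : σ = σ' := by
  -- `Y` is injective: `Y = X ∘ σ⁻¹`
  have hY : Function.Injective Y := fun j j' h => by
    have := hX ((hσ (σ.symm j)).trans (by rw [Equiv.apply_symm_apply, h, ← Equiv.apply_symm_apply σ j', ← hσ]))
    simpa using this
  exact Equiv.ext fun i => hY ((hσ i).symm.trans (hσ' i))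

end GenProd

section Norms

variable {𝕜 : Type*} [RCLike 𝕜] {Γ : Type*} [DecidableEq Γ]

/-- **The delta determinant of an injective `X` has norm at most one** (at most one permutation
matches, `perm_eq_of_forall_eq`). [folklore] -/
theorem norm_det_deltaMatrix_le_one {m : ℕ} {X : Fin m → Γ} (hX : Function.Injective X) (Y : Fin m → Γ) :
    ‖(deltaMatrix 𝕜 X Y).det‖ ≤ 1 := by
  classical
  rw [Matrix.det_apply']
  -- each term is `± ∏ δ`, nonzero for at most one permutation
  have hsign : ∀ σ : Equiv.Perm (Fin m), ‖((Equiv.Perm.sign σ : ℤ) : 𝕜)‖ = 1 := fun σ => by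
    rcases Int.units_eq_one_or (Equiv.Perm.sign σ) with h | h <;> simp [h]
  have hterm : ∀ σ : Equiv.Perm (Fin m),
      ‖((Equiv.Perm.sign σ : ℤ) : 𝕜) * ∏ i, deltaMatrix 𝕜 X Y (σ i) i‖ = if ∀ i, X (σ i) = Y i then 1 else 0 := by
    intro σ
    rw [norm_mul, hsign, one_mul]
    by_cases h : ∀ i, X (σ i) = Y i
    · rw [if_pos h, prod_congr rfl fun i _ => by rw [deltaMatrix_apply, if_pos (h i)], prod_const_one, norm_one]
    · rw [if_neg h]
      push Not at h
      obtain ⟨i, hi⟩ := h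
      rw [prod_eq_zero (mem_univ i) (by rw [deltaMatrix_apply, if_neg hi]), norm_zero]
  refine (norm_sum_le _ _).trans ?_
  simp_rw [hterm]
  rw [Finset.sum_boole]
  -- at most one matching permutation
  have hcard : ((univ : Finset (Equiv.Perm (Fin m))).filter fun σ => ∀ i, X (σ i) = Y i).card ≤ 1 := by
    refine card_le_one.2 fun σ hσ σ' hσ' => ?_
    have h1 := (mem_filter.1 hσ).2
    have h2 := (mem_filter.1 hσ').2
    -- pass to `X i = Y (σ⁻¹ i)`
    have := perm_eq_of_forall_eq (Y := Y) hX (σ := σ.symm) (σ' := σ'.symm)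
      (fun i => by simpa using h1 (σ.symm i)) (fun i => by simpa using h2 (σ'.symm i))
    simpa using congrArg Equiv.symm this
  exact_mod_cast hcard

/-- **The kernel of a product of `m` generators is bounded by `(m!)⁻¹`** for injective arguments and
vanishes otherwise. [folklore] -/
theorem norm_kernel_genProd_le {m : ℕ} (X Y : Fin m → Γ) :
    ‖kernel 𝕜 (genProd 𝕜 Y) m X‖ ≤ (m.factorial : ℝ)⁻¹ := by
  rw [kernel_genProd, norm_mul]
  have hfac : ‖((m.factorial : ℚ)⁻¹ • (1 : 𝕜))‖ = (m.factorial : ℝ)⁻¹ := by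
    rw [Rat.smul_one_eq_cast, Rat.cast_inv, Rat.cast_natCast, norm_inv, RCLike.norm_natCast]
  rw [hfac]
  refine mul_le_of_le_one_right (by positivity) ?_
  by_cases hX : Function.Injective X
  · exact norm_det_deltaMatrix_le_one hX Y
  · rw [deltaMatrix_det_eq_zero_of_not_injective 𝕜 hX Y, norm_zero]
    exact zero_le_one

end Norms

end Literature.MathematicalPhysics.QuantumLattice
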